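import Literature.Geometry.Kaehler.ComplexTorusHodgeGroupPiAnyNonCMEllipticCurvesProduct
import HarnessLib

/-!
# Condition (D) in full for `A = X₁ × ⋯ × X_K × Y`: the POWERS `Aⁿ` — `Hg(Aⁿ) = Lf(Aⁿ) ⟺ Hg(Y) = Lf(Y)` and
# `D = B` on every `Yⁿ` ⟹ `D = B` on every `Aⁿ` (all codimensions), for one-dimensional complex tori `X_k` without
# complex multiplication and ANY torus `Y` with commutative `Hg(Y)(ℂ)`; on the Hodge-circle locus unconditionally
# (Moonen–Zarhin 1999 §1 "`𝒟•(Xⁿ) = ℬ•(Xⁿ)` for all `n`", §3 Theorem (2) "`X₁ × X₂` again satisfies (D)", §3 Corollary)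

Layer `Literature/Geometry/Kaehler`, namespace `Literature.Geometry.Kaehler.ComplexTorus`; lane `lit-hodgefound`
(Track 2 foundations library), Layer A4; prover seat `lit-hodgefound-p17` (generation 36, self-proposed row g36-#7 =
the powers clause left open in g36-#6's faithfulness note (ii)). Consumed BY NAME, nothing restated: g36-#6
`ComplexTorusHodgeGroupPiAnyNonCMEllipticCurvesProduct` (the product formula, the `D = B` transfer and the criterion for
`(∏_k X_k) × Y`, `isAbelianVariety_pi_of_dimOne`), `ComplexTorusProductPowerIsomorphisms` (`isIsomorphic_of_reindex`,
`isIsomorphic_powPeriod_prodPeriod`: `(X₁ × X₂)ⁿ ≅ X₁ⁿ × X₂ⁿ`, `IsIsomorphic.prod`), `ComplexTorusLefschetzGroupPower`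
(`IsRiemannForm.lefschetzGroup_pow`: `Lf(Xⁿ) = Δₙ Lf(X)`, `diagPowSL_injective`), `ComplexTorusHodgeGroupFunctoriality`
(`hodgeGroup_pow`: `Hg(Xⁿ) = Δₙ Hg(X)`, `IsIsogeny.hodgeGroup_eq_map_conjSL`), `ComplexTorusCentralizerIsogeny`
(`IsIsogeny.lefschetzGroup_eq_map_conjSL`, `conjSL_injective`), `ComplexTorusZarhinTrick` (`IsRiemannForm.pow`),
`ComplexTorusHodgeGroupComplexPointsTransport` (`hodgeGroupC_pow_comm_iff`), `ComplexTorusDivisorClassesIsogeny`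
(`IsIsogenous.forall_divisorClasses_eq_hodgeClasses_iff`), g33 / g35-#2 / g36-#2 (the locus: `isAbelianVariety_sigmaPiPeriod_of_coe_eq_range`,
`IsRiemannForm.lefschetzGroup_sigmaPiPeriod_eq_hodgeGroup_of_coe_eq_range`, `hodgeGroupC_sigmaPiPeriod_comm_of_coe_eq_range`,
`divisorClasses_sigmaPiPeriod_eq_hodgeClasses_of_coe_eq_range`). THEOREMS ONLY (no definition, no instance, no notation, no
named fact; D-0026 net debt 0).

## Sources, verbatim

* B. Moonen, Yu. G. Zarhin, Math. Ann. **315** (1999) (held `paper:arxiv-math_9901113`), §1 p0004 L62–L78: condition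
  (D) "`𝒟•(Xⁿ) = ℬ•(Xⁿ)` for all `n`" and "It was shown by Hazama and Murty (independently) that `Hg(X) = Sp_D(V, φ)` ⟺
  (`X` has no factors of type III and `𝒟•(Xⁿ) = ℬ•(Xⁿ)` for all `n`)"; §1 p0002 L138–L141 ("For `n ≥ 1` we can identify
  `Hg(Xⁿ)` with `Hg(X)`, acting diagonally on `V_{Xⁿ} = (V_X)ⁿ`"); §3 Theorem (Hazama) (2), p0006 L74–L78 ("Then
  `X₁ × X₂` again satisfies (D)"); §3 Corollary, p0007 L80–L85 ("every product of elliptic curves satisfies condition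
  (D)").
* H. Lange, *Abelian Varieties over the Complex Numbers* (2023), §7.2.4 Exercise (4) ((a) `Lf` independent of the
  polarisation, (c) products and powers), Exercise (5); §7.3.3 Exercise (1)(b) (isogeny invariance of `D = B`); §2.4.4
  Cor. 2.4.26 (the powers `X_ν^{n_ν}`).
* J. S. Milne, *Lefschetz classes on abelian varieties*, Duke Math. J. **96** (1999), §1 p. 643 (`C(Xⁿ) = Δₙ C(X)`),
  §4 Prop. 4.8.
* B. B. Gordon (1999), 7.5 Theorem ("`Hdg(A^k) = Div(A^k)` for all `k ≥ 1` ⟺ no factor of type (III) and `Hg(A) = Lf(A)`").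

## What is proved (`X_k` one-dimensional with `End_ℚ(X_k) = ℚ`, any; `Y` with commutative `Hg(Y)(ℂ)`; `A = (∏_k X_k) × Y`)

* §1 Two transports and two reindexings (general): **`Hg = Lf` is an isogeny invariant** for polarised tori
  (`IsIsogeny.hodgeGroup_eq_lefschetzGroup_iff`, `IsIsogenous.hodgeGroup_eq_lefschetzGroup_iff`: both sides are
  conjugated by the same `V(f)`); **`Hg(Xⁿ) = Lf(Xⁿ) ⟺ Hg(X) = Lf(X)`** (`n ≥ 1`, any polarisations; both sides are the
  diagonal images, `IsRiemannForm.hodgeGroup_pow_eq_lefschetzGroup_iff`); **`(∏_k X_k)ⁿ ≅ ∏_{(j,k)} X_k`** for a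
  homogeneous family (`isIsomorphic_powPeriod_piPeriod`, index `Fin (n·K)` via `finProdFinEquiv`) and for a dependent
  family (`isIsomorphic_powPeriod_sigmaPiPeriod`, index `Fin n × κ`); hence `Aⁿ ≅ (∏_{(j,k)} X_k) × Yⁿ`
  (`isIsomorphic_pow_pi_prod`).
* §2 **THE POWERS OF `A`: `Hg(Aⁿ) = Lf(Aⁿ, η) ⟺ Hg(Y) = Lf(Y, η₂)`** for every `n ≥ 1` and all polarisations
  (`IsRiemannForm.hodgeGroup_pow_pi_prod_eq_lefschetzGroup_iff_of_comm`), and **`D = B` on `Yⁿ` (all codimensions) ⟹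
  `D = B` on `Aⁿ` (all codimensions)** (`forall_divisorClasses_pow_pi_prod_eq_hodgeClasses_of_comm`: g36-#6's transfer on
  `(∏_{(j,k)} X_k) × Yⁿ`, `Hg(Yⁿ)(ℂ)` being commutative with `Hg(Y)(ℂ)`); together **CONDITION (D) TRANSFERS FROM `Y` TO
  `A`** (`hodgeGroup_eq_lefschetzGroup_and_forall_pow_of_comm`) — "`X₁ × X₂` again satisfies (D)" for `X₁ =` any product
  of non-CM elliptic curves, both halves, all powers.
* §3 The `E_τ` wording (only `End(E_{τ_k}) = ℤ`) and **THE LOCUS, UNCONDITIONALLY, ALL POWERS: `Hg((X₁ × ⋯ × X_K × ∏ₗ Z_l)ⁿ) = Lf`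
  for every polarisation and `D = B` on `(X₁ × ⋯ × X_K × ∏ₗ Z_l)ⁿ` in every codimension, every `n ≥ 1`**
  (`IsRiemannForm.hodgeGroup_pow_pi_prod_sigmaPiPeriod_eq_lefschetzGroup`,
  `forall_divisorClasses_pow_pi_prod_sigmaPiPeriod_eq_hodgeClasses`; `(∏ₗ Z_l)ⁿ ≅ ∏_{(j,l)} Z_l` is again on the locus).

Faithfulness notes. (i) The type-III clause of the Hazama–Murty criterion is not formalised (products of elliptic
curves and locus tori have no type-III factor; not needed for the statements proved). (ii) `n = 0` (a point) is
excluded from the power statements.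

## References

* [MoonenZarhin1999LowDim] B. Moonen, Yu. G. Zarhin, Math. Ann. 315 (1999), §1 (condition (D), powers), §3 Theorem (2), §3 Corollary.
* [Lange2023AbelianVarietiesComplex] H. Lange (2023), §7.2.4 Exercises (4), (5), §7.3.3 Exercise (1)(b), §2.4.4 Cor. 2.4.26.
* [Milne1999LefschetzClasses] J. S. Milne, Duke Math. J. 96 (1999), §1, §4 Prop. 4.8.
* [Gordon1997] B. B. Gordon (1999), 7.5 Theorem, 2.15 Lemma.
-/

noncomputable section

open scoped Real MatrixGroups
open Complex Module Matrix Function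

namespace Literature.Geometry.Kaehler

namespace ComplexTorus

/-! ## §1 `Hg = Lf` along isogenies and powers; `(∏_k X_k)ⁿ` as a product family -/

section Transport

variable {ι₁ ι₂ : Type*} [Fintype ι₁] [Fintype ι₂] [DecidableEq ι₁] [DecidableEq ι₂]
  {E₁ E₂ : Type*} [NormedAddCommGroup E₁] [NormedSpace ℂ E₁] [NormedAddCommGroup E₂] [NormedSpace ℂ E₂]
  {Φ₁ : (ι₁ → ℝ) ≃L[ℝ] E₁} {Φ₂ : (ι₂ → ℝ) ≃L[ℝ] E₂} {η₁ : E₁ [⋀^Fin 2]→L[ℝ] ℝ} {η₂ : E₂ [⋀^Fin 2]→L[ℝ] ℝ}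

/-- **`Hg = Lf` is an isogeny invariant of polarised complex tori**: for an isogeny `f : X₁ → X₂`,
`Hg(X₂) = V(f) Hg(X₁) V(f)⁻¹` and `Lf(X₂) = V(f) Lf(X₁) V(f)⁻¹` (the tree's transports), so `Hg(X₁) = Lf(X₁)` iff
`Hg(X₂) = Lf(X₂)` (real points, any polarisations). [cite: Lange2023AbelianVarietiesComplex, §7.2.4 Exercise (4)(a) and §7.3.3 Exercise (1)(b)]
[cite: Milne1999LefschetzClasses, §1 (p. 644)] [cite: MoonenZarhin1999LowDim, (0.2)(4)] -/
theorem IsIsogeny.hodgeGroup_eq_lefschetzGroup_iff {A : Matrix ι₂ ι₁ ℤ} (hA : IsIsogeny Φ₁ Φ₂ A)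
    (h₁ : IsRiemannForm Φ₁ η₁) (h₂ : IsRiemannForm Φ₂ η₂) :
    hodgeGroup Φ₁ = lefschetzGroup Φ₁ η₁ ↔ hodgeGroup Φ₂ = lefschetzGroup Φ₂ η₂ := by
  obtain ⟨Q, hQ, hQP, hPQ⟩ := hA.exists_homRat_inverse
  rw [hA.lefschetzGroup_eq_map_conjSL h₁ h₂ hQ hQP hPQ, hA.hodgeGroup_eq_map_conjSL hQP hPQ]
  exact ⟨fun h ↦ by rw [h], fun h ↦ Subgroup.map_injective (conjSL_injective _ _ _ _) h⟩

/-- **Isogenous polarised tori: `Hg(X₁) = Lf(X₁) ⟺ Hg(X₂) = Lf(X₂)`.** [cite: Lange2023AbelianVarietiesComplex, §7.2.4 Exercise (4)(a) and §7.3.3 Exercise (1)(b)]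
[cite: MoonenZarhin1999LowDim, (0.2)(4)] -/
theorem IsIsogenous.hodgeGroup_eq_lefschetzGroup_iff (h : IsIsogenous Φ₁ Φ₂) (h₁ : IsRiemannForm Φ₁ η₁)
    (h₂ : IsRiemannForm Φ₂ η₂) : hodgeGroup Φ₁ = lefschetzGroup Φ₁ η₁ ↔ hodgeGroup Φ₂ = lefschetzGroup Φ₂ η₂ := by
  obtain ⟨A, hA⟩ := h
  exact hA.hodgeGroup_eq_lefschetzGroup_iff h₁ h₂

/-- **`Hg(Xⁿ) = Lf(Xⁿ) ⟺ Hg(X) = Lf(X)`** (`n ≥ 1`, any polarisations): "we can identify `Hg(Xⁿ)` with `Hg(X)`, acting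
diagonally" (`hodgeGroup_pow`) and `Lf(Xⁿ) = Δₙ Lf(X)` (`IsRiemannForm.lefschetzGroup_pow`), `Δₙ` injective.
[cite: MoonenZarhin1999LowDim, §1 (p0002 L138–L141)] [cite: Lange2023AbelianVarietiesComplex, §7.2.4 Exercise (4)(a), (c)]
[cite: Milne1999LefschetzClasses, §1 (p. 643)] -/
theorem IsRiemannForm.hodgeGroup_pow_eq_lefschetzGroup_iff [FiniteDimensional ℂ E₁] (hω : IsRiemannForm Φ₁ η₁) {n : ℕ}
    (hn : 0 < n) {η : (Fin n → E₁) [⋀^Fin 2]→L[ℝ] ℝ} (hη : IsRiemannForm (powPeriod Φ₁ n) η) :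
    hodgeGroup (powPeriod Φ₁ n) = lefschetzGroup (powPeriod Φ₁ n) η ↔ hodgeGroup Φ₁ = lefschetzGroup Φ₁ η₁ := by
  rw [hη.lefschetzGroup_eq (hω.pow n), hω.lefschetzGroup_pow n, hodgeGroup_pow n Φ₁]
  exact ⟨fun h ↦ Subgroup.map_injective (diagPowSL_injective n hn) h, fun h ↦ by rw [h]⟩

end Transport

section Reindex

variable {K : ℕ} {ι : Type*} [Fintype ι] [DecidableEq ι] {E : Type*} [NormedAddCommGroup E] [NormedSpace ℂ E]

/-- **`(X₁ × ⋯ × X_K)ⁿ ≅ ∏_{(j,k)} X_k`** (flatten the double index `(j, k) ↦ finProdFinEquiv (j, k) < n·K`): the power of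
a finite product is the finite product of the family repeated `n` times.
[cite: Lange2023AbelianVarietiesComplex, §2.4.4 Cor. 2.4.26 (the powers `X_ν^{n_ν}`) and §1.1.2 (products, p. 21)] -/
theorem isIsomorphic_powPeriod_piPeriod (Θ : Fin K → ((ι → ℝ) ≃L[ℝ] E)) (n : ℕ) :
    IsIsomorphic (powPeriod (piPeriod Θ) n) (piPeriod fun jk : Fin (n * K) ↦ Θ (finProdFinEquiv.symm jk).2) := by
  refine isIsomorphic_of_reindex _ _
    ((Equiv.prodAssoc (Fin n) (Fin K) ι).symm.trans (Equiv.prodCongr finProdFinEquiv (Equiv.refl ι)))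
    (ContinuousLinearMap.pi fun jk ↦ (ContinuousLinearMap.proj (finProdFinEquiv.symm jk).2).comp
      (ContinuousLinearMap.proj (R := ℂ) (φ := fun _ : Fin n ↦ Fin K → E) (finProdFinEquiv.symm jk).1))
    fun x ↦ ?_
  funext jk
  rw [piPeriod_apply, ContinuousLinearMap.pi_apply, ContinuousLinearMap.comp_apply,
    ContinuousLinearMap.proj_apply, ContinuousLinearMap.proj_apply, powPeriod_apply, piPeriod_apply]
  congr 1

/-- **`(∏ₗ Z_l)ⁿ ≅ ∏_{(j,l)} Z_l`** for a dependent finite family (index `Fin n × κ`).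
[cite: Lange2023AbelianVarietiesComplex, §2.4.4 Thm. 2.4.25 and Cor. 2.4.26] -/
theorem isIsomorphic_powPeriod_sigmaPiPeriod {κ : Type*} [Fintype κ] [DecidableEq κ] {σ : κ → Type*}
    [∀ l, Fintype (σ l)] [∀ l, DecidableEq (σ l)] {F : κ → Type*} [∀ l, NormedAddCommGroup (F l)]
    [∀ l, NormedSpace ℂ (F l)] (Ψ : ∀ l, (σ l → ℝ) ≃L[ℝ] F l) (n : ℕ) :
    IsIsomorphic (powPeriod (sigmaPiPeriod Ψ) n) (sigmaPiPeriod fun jl : Fin n × κ ↦ Ψ jl.2) := by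
  refine isIsomorphic_of_reindex _ _
    { toFun := fun p ↦ ⟨(p.1, p.2.1), p.2.2⟩, invFun := fun q ↦ (q.1.1, ⟨q.1.2, q.2⟩),
      left_inv := fun _ ↦ rfl, right_inv := fun _ ↦ rfl }
    (ContinuousLinearMap.pi fun jl : Fin n × κ ↦ (ContinuousLinearMap.proj (R := ℂ) (φ := fun l ↦ F l) jl.2).comp
      (ContinuousLinearMap.proj (R := ℂ) (φ := fun _ : Fin n ↦ ∀ l, F l) jl.1))
    fun x ↦ ?_
  funext jl
  rw [sigmaPiPeriod_apply, ContinuousLinearMap.pi_apply, ContinuousLinearMap.comp_apply,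
    ContinuousLinearMap.proj_apply, ContinuousLinearMap.proj_apply, powPeriod_apply, sigmaPiPeriod_apply]
  congr 1

variable (X : Fin K → ((Fin 2 → ℝ) ≃L[ℝ] ℂ)) {ι₂ : Type*} [Fintype ι₂] [DecidableEq ι₂]
  {E₂ : Type*} [NormedAddCommGroup E₂] [NormedSpace ℂ E₂] (Φ₂ : (ι₂ → ℝ) ≃L[ℝ] E₂)

omit [Fintype ι] [DecidableEq ι] [NormedAddCommGroup E] [NormedSpace ℂ E] in
/-- **`(X₁ × ⋯ × X_K × Y)ⁿ ≅ (∏_{(j,k)} X_k) × Yⁿ`** (`(X₁ × X₂)ⁿ ≅ X₁ⁿ × X₂ⁿ` and the previous lemma).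
[cite: Lange2023AbelianVarietiesComplex, §2.4.4 Cor. 2.4.26] -/
theorem isIsomorphic_pow_pi_prod (n : ℕ) :
    IsIsomorphic (powPeriod (prodPeriod (piPeriod X) Φ₂) n)
      (prodPeriod (piPeriod fun jk : Fin (n * K) ↦ X (finProdFinEquiv.symm jk).2) (powPeriod Φ₂ n)) :=
  (isIsomorphic_powPeriod_prodPeriod (piPeriod X) Φ₂ n).trans
    ((isIsomorphic_powPeriod_piPeriod X n).prod (IsIsomorphic.refl _))

end Reindex

/-! ## §2 The powers of `A = X₁ × ⋯ × X_K × Y`: condition (D) transfers from `Y` to `A` -/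

section Powers

variable {K : ℕ} (X : Fin K → ((Fin 2 → ℝ) ≃L[ℝ] ℂ)) {ι₂ : Type*} [Fintype ι₂] [DecidableEq ι₂]
  {E₂ : Type*} [NormedAddCommGroup E₂] [NormedSpace ℂ E₂] (Φ₂ : (ι₂ → ℝ) ≃L[ℝ] E₂)
  (hX : ∀ k, endAlgRat (X k) = ⊥)
  (hcomm : ∀ M N : SpecialLinearGroup ι₂ ℂ, M ∈ hodgeGroupC Φ₂ → N ∈ hodgeGroupC Φ₂ → M.1 * N.1 = N.1 * M.1)

include hcomm in
/-- `Hg(Yⁿ)(ℂ)` is commutative with `Hg(Y)(ℂ)` (`n ≥ 1`; the tree's `hodgeGroupC_pow_comm_iff`).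
[cite: MoonenZarhin1999LowDim, §1 (p0002 L138–L141)] -/
theorem hodgeGroupC_pow_coe_mul_comm {n : ℕ} (hn : 0 < n) (M N : SpecialLinearGroup (Fin n × ι₂) ℂ)
    (hM : M ∈ hodgeGroupC (powPeriod Φ₂ n)) (hN : N ∈ hodgeGroupC (powPeriod Φ₂ n)) : M.1 * N.1 = N.1 * M.1 :=
  congrArg Subtype.val
    ((hodgeGroupC_pow_comm_iff Φ₂ n hn).2 (fun M hM N hN ↦ Subtype.ext (hcomm M N hM hN)) M hM N hN)

include hX hcomm in
/-- **`D = B` ON THE POWERS: `Dᵇ(Yⁿ) = H^{2b}_Hodge(Yⁿ)` for all `b` ⟹ `Dᵖ((X₁ × ⋯ × X_K × Y)ⁿ) = H^{2p}_Hodge` for all `p`**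
(`n ≥ 1`): `Aⁿ ≅ (∏_{(j,k)} X_k) × Yⁿ` is again a product of non-CM one-dimensional tori with a torus of commutative
`Hg(ℂ)`, so g36-#6's `D = B` transfer applies, and `D = B` is an isogeny invariant — the `D = B` half of "`X₁ × X₂`
again satisfies (D)" ("`𝒟•(Xⁿ) = ℬ•(Xⁿ)` for all `n`"). [cite: MoonenZarhin1999LowDim, §3 Theorem (2) (p0006 L74–L78) with §1 (p0004 L62–L78)]
[cite: Lange2023AbelianVarietiesComplex, §7.3.3 Exercise (1)(b)] [cite: Gordon1997, 7.5 Theorem] -/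
theorem forall_divisorClasses_pow_pi_prod_eq_hodgeClasses_of_comm {n : ℕ} (hn : 0 < n)
    (hY : ∀ b, divisorClasses (powPeriod Φ₂ n) b = hodgeClasses (powPeriod Φ₂ n) b) (p : ℕ) :
    divisorClasses (powPeriod (prodPeriod (piPeriod X) Φ₂) n) p =
      hodgeClasses (powPeriod (prodPeriod (piPeriod X) Φ₂) n) p := by
  refine (((isIsomorphic_pow_pi_prod X Φ₂ n).isIsogenous.forall_divisorClasses_eq_hodgeClasses_iff _ _).2
    fun q ↦ ?_) p
  exact forall_divisorClasses_pi_prod_eq_hodgeClasses_of_forall_endAlgRat_eq_bot_of_comm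
    (fun jk ↦ X (finProdFinEquiv.symm jk).2) (powPeriod Φ₂ n) (fun _ ↦ hX _)
    (hodgeGroupC_pow_coe_mul_comm Φ₂ hcomm hn) hY q

include hX hcomm in
/-- **ALL POWERS: `D = B` on every `Yⁿ` ⟹ `D = B` on every `(X₁ × ⋯ × X_K × Y)ⁿ`** (`n ≥ 1`, all codimensions).
[cite: MoonenZarhin1999LowDim, §3 Theorem (2) with §1 (condition (D))] [cite: Gordon1997, 7.5 Theorem] -/
theorem forall_divisorClasses_pow_pi_prod_eq_hodgeClasses_of_forall_of_comm
    (hY : ∀ n b, divisorClasses (powPeriod Φ₂ n) b = hodgeClasses (powPeriod Φ₂ n) b) {n : ℕ} (hn : 0 < n) (p : ℕ) :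
    divisorClasses (powPeriod (prodPeriod (piPeriod X) Φ₂) n) p =
      hodgeClasses (powPeriod (prodPeriod (piPeriod X) Φ₂) n) p :=
  forall_divisorClasses_pow_pi_prod_eq_hodgeClasses_of_comm X Φ₂ hX hcomm hn (hY n) p

include hX hcomm in
/-- **`Hg((X₁ × ⋯ × X_K × Y)ⁿ) = Lf((X₁ × ⋯ × X_K × Y)ⁿ, η) ⟺ Hg(Y) = Lf(Y, η₂)`** for every `n ≥ 1` and all polarisations
(`Hg(Aⁿ) = Lf(Aⁿ) ⟺ Hg(A) = Lf(A)` by the diagonal identifications, then g36-#6's criterion) — the group half of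
"`X₁ × X₂` again satisfies (D)" on all powers. [cite: MoonenZarhin1999LowDim, §3 Theorem (2) with §1 (p0002 L138–L141, p0004 L71–L78)]
[cite: Gordon1997, 7.5 Theorem (b)] [cite: Lange2023AbelianVarietiesComplex, §7.2.4 Exercises (4), (5)] -/
theorem IsRiemannForm.hodgeGroup_pow_pi_prod_eq_lefschetzGroup_iff_of_comm [FiniteDimensional ℂ E₂]
    {ω₂ : E₂ [⋀^Fin 2]→L[ℝ] ℝ} (h₂ : IsRiemannForm Φ₂ ω₂) {n : ℕ} (hn : 0 < n)
    {η : (Fin n → (Fin K → ℂ) × E₂) [⋀^Fin 2]→L[ℝ] ℝ} (hη : IsRiemannForm (powPeriod (prodPeriod (piPeriod X) Φ₂) n) η)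
    {η₂ : E₂ [⋀^Fin 2]→L[ℝ] ℝ} (hη₂ : IsRiemannForm Φ₂ η₂) :
    hodgeGroup (powPeriod (prodPeriod (piPeriod X) Φ₂) n) = lefschetzGroup (powPeriod (prodPeriod (piPeriod X) Φ₂) n) η ↔
      hodgeGroup Φ₂ = lefschetzGroup Φ₂ η₂ := by
  obtain ⟨ω₁, h₁⟩ := isAbelianVariety_pi_of_dimOne X
  rw [(h₁.prod h₂).hodgeGroup_pow_eq_lefschetzGroup_iff hn hη]
  exact IsRiemannForm.hodgeGroup_pi_prod_eq_lefschetzGroup_iff_of_forall_endAlgRat_eq_bot_of_comm X Φ₂ hX hcomm h₂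
    (h₁.prod h₂) hη₂

include hX hcomm in
/-- **`Hg(Y) = Lf(Y) ⟹ Hg((X₁ × ⋯ × X_K × Y)ⁿ) = Lf((X₁ × ⋯ × X_K × Y)ⁿ, η)`** for every `n ≥ 1` and every polarisation `η`.
[cite: MoonenZarhin1999LowDim, §3 Theorem (2) with §1] [cite: Gordon1997, 7.5 Theorem (b)] -/
theorem IsRiemannForm.hodgeGroup_pow_pi_prod_eq_lefschetzGroup_of_comm [FiniteDimensional ℂ E₂]
    {ω₂ : E₂ [⋀^Fin 2]→L[ℝ] ℝ} (h₂ : IsRiemannForm Φ₂ ω₂) (hL : hodgeGroup Φ₂ = lefschetzGroup Φ₂ ω₂) {n : ℕ} (hn : 0 < n)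
    {η : (Fin n → (Fin K → ℂ) × E₂) [⋀^Fin 2]→L[ℝ] ℝ} (hη : IsRiemannForm (powPeriod (prodPeriod (piPeriod X) Φ₂) n) η) :
    hodgeGroup (powPeriod (prodPeriod (piPeriod X) Φ₂) n) = lefschetzGroup (powPeriod (prodPeriod (piPeriod X) Φ₂) n) η :=
  (IsRiemannForm.hodgeGroup_pow_pi_prod_eq_lefschetzGroup_iff_of_comm X Φ₂ hX hcomm h₂ hn hη h₂).2 hL

include hX hcomm in
/-- **CONDITION (D) TRANSFERS FROM `Y` TO `A = X₁ × ⋯ × X_K × Y`** (both halves, torus level): if `Hg(Y) = Lf(Y)` and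
`D = B` on every power `Yⁿ` in every codimension, then `Hg(Aⁿ) = Lf(Aⁿ, η)` for every polarisation `η` and `D = B` on
`Aⁿ` in every codimension, for every `n ≥ 1` — "Suppose `X₁` has no factors of Type IV and `X₂` is of CM-type. Then
`X₁ × X₂` again satisfies (D)", `X₁ =` any product of elliptic curves without complex multiplication.
[cite: MoonenZarhin1999LowDim, §3 Theorem (2) (p0006 L74–L78) with §1 (p0004 L62–L78)] [cite: Gordon1997, 7.5 Theorem] -/
theorem hodgeGroup_pow_eq_lefschetzGroup_and_forall_divisorClasses_pow_of_comm [FiniteDimensional ℂ E₂]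
    {ω₂ : E₂ [⋀^Fin 2]→L[ℝ] ℝ} (h₂ : IsRiemannForm Φ₂ ω₂) (hL : hodgeGroup Φ₂ = lefschetzGroup Φ₂ ω₂)
    (hY : ∀ n b, divisorClasses (powPeriod Φ₂ n) b = hodgeClasses (powPeriod Φ₂ n) b) {n : ℕ} (hn : 0 < n)
    {η : (Fin n → (Fin K → ℂ) × E₂) [⋀^Fin 2]→L[ℝ] ℝ} (hη : IsRiemannForm (powPeriod (prodPeriod (piPeriod X) Φ₂) n) η) :
    hodgeGroup (powPeriod (prodPeriod (piPeriod X) Φ₂) n) = lefschetzGroup (powPeriod (prodPeriod (piPeriod X) Φ₂) n) η ∧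
      ∀ p, divisorClasses (powPeriod (prodPeriod (piPeriod X) Φ₂) n) p =
        hodgeClasses (powPeriod (prodPeriod (piPeriod X) Φ₂) n) p :=
  ⟨IsRiemannForm.hodgeGroup_pow_pi_prod_eq_lefschetzGroup_of_comm X Φ₂ hX hcomm h₂ hL hn hη,
    forall_divisorClasses_pow_pi_prod_eq_hodgeClasses_of_forall_of_comm X Φ₂ hX hcomm hY hn⟩

omit [DecidableEq ι₂] in
/-- **`(X₁ × ⋯ × X_K × Y)ⁿ` is an abelian variety** for one-dimensional `X_k` and polarised `Y`.
[cite: Lange2023AbelianVarietiesComplex, §2.4.4 Cor. 2.4.24 and Cor. 2.4.26] -/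
theorem isAbelianVariety_pow_pi_prod_of_dimOne {ω₂ : E₂ [⋀^Fin 2]→L[ℝ] ℝ} (h₂ : IsRiemannForm Φ₂ ω₂) (n : ℕ) :
    IsAbelianVariety (powPeriod (prodPeriod (piPeriod X) Φ₂) n) := by
  obtain ⟨ω₁, h₁⟩ := isAbelianVariety_pi_of_dimOne X
  exact ⟨_, (h₁.prod h₂).pow n⟩

end Powers

/-! ## §3 Elliptic curves `E_{τ_k}`; the locus `Y = ∏ₗ Z_l`, all powers unconditionally -/

section Elliptic

variable {K : ℕ} {τ : Fin K → ℂ} (hτ : ∀ k, (τ k).im ≠ 0) {ι₂ : Type*} [Fintype ι₂] [DecidableEq ι₂]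
  {E₂ : Type*} [NormedAddCommGroup E₂] [NormedSpace ℂ E₂] (Φ₂ : (ι₂ → ℝ) ≃L[ℝ] E₂)
  (hEnd : ∀ k, ellipticEnd (hτ k) = ⊥)
  (hcomm : ∀ M N : SpecialLinearGroup ι₂ ℂ, M ∈ hodgeGroupC Φ₂ → N ∈ hodgeGroupC Φ₂ → M.1 * N.1 = N.1 * M.1)

include hEnd hcomm in
/-- **`D = B` on every `Yⁿ` ⟹ `D = B` on every `(E_{τ_1} × ⋯ × E_{τ_K} × Y)ⁿ`** (`n ≥ 1`, all codimensions), for ANY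
elliptic curves with `End(E_{τ_k}) = ℤ` and any torus `Y` with commutative `Hg(Y)(ℂ)`.
[cite: MoonenZarhin1999LowDim, §3 Theorem (2) with §1 (condition (D))] [cite: Gordon1997, 7.5 Theorem] -/
theorem forall_divisorClasses_pow_pi_ellipticPeriod_prod_eq_hodgeClasses
    (hY : ∀ n b, divisorClasses (powPeriod Φ₂ n) b = hodgeClasses (powPeriod Φ₂ n) b) {n : ℕ} (hn : 0 < n) (p : ℕ) :
    divisorClasses (powPeriod (prodPeriod (piPeriod fun k ↦ ellipticPeriod (hτ k)) Φ₂) n) p =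
      hodgeClasses (powPeriod (prodPeriod (piPeriod fun k ↦ ellipticPeriod (hτ k)) Φ₂) n) p :=
  forall_divisorClasses_pow_pi_prod_eq_hodgeClasses_of_forall_of_comm _ Φ₂
    (fun k ↦ (endAlgRat_ellipticPeriod_eq_bot_iff (hτ k)).2 (hEnd k)) hcomm hY hn p

include hEnd hcomm in
/-- **`Hg((E_{τ_1} × ⋯ × E_{τ_K} × Y)ⁿ) = Lf(·, η) ⟺ Hg(Y) = Lf(Y, η₂)`** (`n ≥ 1`, all polarisations), non-CM `τ_k` arbitrary.
[cite: MoonenZarhin1999LowDim, §3 Theorem (2) with §1] [cite: Gordon1997, 7.5 Theorem (b)] -/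
theorem IsRiemannForm.hodgeGroup_pow_pi_ellipticPeriod_prod_eq_lefschetzGroup_iff [FiniteDimensional ℂ E₂]
    {ω₂ : E₂ [⋀^Fin 2]→L[ℝ] ℝ} (h₂ : IsRiemannForm Φ₂ ω₂) {n : ℕ} (hn : 0 < n)
    {η : (Fin n → (Fin K → ℂ) × E₂) [⋀^Fin 2]→L[ℝ] ℝ}
    (hη : IsRiemannForm (powPeriod (prodPeriod (piPeriod fun k ↦ ellipticPeriod (hτ k)) Φ₂) n) η)
    {η₂ : E₂ [⋀^Fin 2]→L[ℝ] ℝ} (hη₂ : IsRiemannForm Φ₂ η₂) :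
    hodgeGroup (powPeriod (prodPeriod (piPeriod fun k ↦ ellipticPeriod (hτ k)) Φ₂) n) =
        lefschetzGroup (powPeriod (prodPeriod (piPeriod fun k ↦ ellipticPeriod (hτ k)) Φ₂) n) η ↔
      hodgeGroup Φ₂ = lefschetzGroup Φ₂ η₂ :=
  IsRiemannForm.hodgeGroup_pow_pi_prod_eq_lefschetzGroup_iff_of_comm _ Φ₂
    (fun k ↦ (endAlgRat_ellipticPeriod_eq_bot_iff (hτ k)).2 (hEnd k)) hcomm h₂ hn hη hη₂

end Elliptic

section Locus

variable {K : ℕ} (X : Fin K → ((Fin 2 → ℝ) ≃L[ℝ] ℂ))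
  {κ : Type*} [Fintype κ] [DecidableEq κ] {σ : κ → Type*} [∀ l, Fintype (σ l)] [∀ l, DecidableEq (σ l)]
  {F : κ → Type*} [∀ l, NormedAddCommGroup (F l)] [∀ l, NormedSpace ℂ (F l)] [∀ l, FiniteDimensional ℂ (F l)]
  (Ψ : ∀ l, (σ l → ℝ) ≃L[ℝ] F l) (hX : ∀ k, endAlgRat (X k) = ⊥)

/-- **`D = B` on every power `(∏ₗ Z_l)ⁿ` of a finite product of tori on the Hodge-circle locus, every codimension**
(`(∏ₗ Z_l)ⁿ ≅ ∏_{(j,l)} Z_l` is again such a product). [cite: MoonenZarhin1999LowDim, §3 Corollary (p0007 L80–L85) and (3.1)]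
[cite: Lange2023AbelianVarietiesComplex, §7.3.3 Exercise (1)(b)] -/
theorem forall_divisorClasses_pow_sigmaPiPeriod_eq_hodgeClasses_of_coe_eq_range (hg : ∀ l, 0 < finrank ℂ (F l))
    (h : ∀ l, (hodgeGroup (Ψ l) : Set (SpecialLinearGroup (σ l) ℝ)) = Set.range (hodgeCircleSL (Ψ l))) (n b : ℕ) :
    divisorClasses (powPeriod (sigmaPiPeriod Ψ) n) b = hodgeClasses (powPeriod (sigmaPiPeriod Ψ) n) b :=
  ((isIsomorphic_powPeriod_sigmaPiPeriod Ψ n).isIsogenous.forall_divisorClasses_eq_hodgeClasses_iff _ _).2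
    (fun c ↦ divisorClasses_sigmaPiPeriod_eq_hodgeClasses_of_coe_eq_range (fun jl : Fin n × κ ↦ Ψ jl.2)
      (fun jl ↦ hg jl.2) (fun jl ↦ h jl.2) c) b

include hX in
/-- **`D = B` ON EVERY POWER `(X₁ × ⋯ × X_K × ∏ₗ Z_l)ⁿ` IN EVERY CODIMENSION, UNCONDITIONALLY** — ANY one-dimensional tori
`X_k` without complex multiplication times ANY finite family of positive-dimensional tori on the Hodge-circle locus:
"every product of elliptic curves satisfies condition (D)", the `𝒟•(Xⁿ) = ℬ•(Xⁿ)` half, all powers, with CM blocks of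
any dimension. [cite: MoonenZarhin1999LowDim, §3 Corollary (p0007 L80–L85), §3 Theorem (2) and §1 (condition (D))]
[cite: Gordon1997, 7.5 Theorem and §3 Theorem] -/
theorem forall_divisorClasses_pow_pi_prod_sigmaPiPeriod_eq_hodgeClasses (hg : ∀ l, 0 < finrank ℂ (F l))
    (h : ∀ l, (hodgeGroup (Ψ l) : Set (SpecialLinearGroup (σ l) ℝ)) = Set.range (hodgeCircleSL (Ψ l))) {n : ℕ}
    (hn : 0 < n) (p : ℕ) :
    divisorClasses (powPeriod (prodPeriod (piPeriod X) (sigmaPiPeriod Ψ)) n) p =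
      hodgeClasses (powPeriod (prodPeriod (piPeriod X) (sigmaPiPeriod Ψ)) n) p :=
  forall_divisorClasses_pow_pi_prod_eq_hodgeClasses_of_forall_of_comm X (sigmaPiPeriod Ψ) hX
    (fun _ _ hM hN ↦ congrArg Subtype.val (hodgeGroupC_sigmaPiPeriod_comm_of_coe_eq_range Ψ h hM hN))
    (fun m b ↦ forall_divisorClasses_pow_sigmaPiPeriod_eq_hodgeClasses_of_coe_eq_range Ψ hg h m b) hn p

include hX in
/-- **`Hg((X₁ × ⋯ × X_K × ∏ₗ Z_l)ⁿ) = Lf((X₁ × ⋯ × X_K × ∏ₗ Z_l)ⁿ, η)` FOR EVERY `n ≥ 1` AND EVERY POLARISATION `η`,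
UNCONDITIONALLY** (the group half, all powers). [cite: MoonenZarhin1999LowDim, §3 Corollary, §3 Theorem (2) and §1 (Hazama–Murty)]
[cite: Gordon1997, 7.5 Theorem (b)] [cite: Lange2023AbelianVarietiesComplex, §7.2.4 Exercises (4), (5)] -/
theorem IsRiemannForm.hodgeGroup_pow_pi_prod_sigmaPiPeriod_eq_lefschetzGroup (hg : ∀ l, 0 < finrank ℂ (F l))
    (h : ∀ l, (hodgeGroup (Ψ l) : Set (SpecialLinearGroup (σ l) ℝ)) = Set.range (hodgeCircleSL (Ψ l))) {n : ℕ}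
    (hn : 0 < n) {η : (Fin n → (Fin K → ℂ) × ∀ l, F l) [⋀^Fin 2]→L[ℝ] ℝ}
    (hη : IsRiemannForm (powPeriod (prodPeriod (piPeriod X) (sigmaPiPeriod Ψ)) n) η) :
    hodgeGroup (powPeriod (prodPeriod (piPeriod X) (sigmaPiPeriod Ψ)) n) =
      lefschetzGroup (powPeriod (prodPeriod (piPeriod X) (sigmaPiPeriod Ψ)) n) η := by
  obtain ⟨ω₂, h₂⟩ := isAbelianVariety_sigmaPiPeriod_of_coe_eq_range Ψ hg h
  exact IsRiemannForm.hodgeGroup_pow_pi_prod_eq_lefschetzGroup_of_comm X (sigmaPiPeriod Ψ) hX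
    (fun _ _ hM hN ↦ congrArg Subtype.val (hodgeGroupC_sigmaPiPeriod_comm_of_coe_eq_range Ψ h hM hN)) h₂
    (h₂.lefschetzGroup_sigmaPiPeriod_eq_hodgeGroup_of_coe_eq_range Ψ hg h).symm hn hη

end Locus

end ComplexTorus

end Literature.Geometry.Kaehler

end
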